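import Summits.ValiantsHypothesis.ValiantsHypothesis.Theorems.DualUnipotentThreeHalves.Negative.HeavyTopInstBlockPaths

/-!
# `GrenetZeon.DualUnipotentThreeHalves` (stmt-ValiantsHypothesis-24318) — NEGATIVE lane, power currency:
# PATTERN PENCILS ARE REDUCIBLE (`pencilAlg N ≠ ⊤`), SO THE CENSUS PRICES **RED**: ANY CONSTANT OF `RedSlowLaw` IS `≥ 2`; IRR IS NOT TOUCHED

Experiment cell «val-heavytop-census» (D-0160), engine seat val-htc-eng-1 (g3), kit 0.  Companion of ✓ p689153 `…Negative.HeavyTopInstBlockPaths`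
(block paths: every row `n ≥ 3` of the `C₀ = 1` grid has a ✗ cell; any constant of R2 / R2ᵖ is `≥ 2`).  The successor head currency of 24318
splits R2ᵖ `HeavyTopSlowLaw` by excluded middle on `pencilAlg N = ⊤` into IRR (`IrrSlowLaw`, research stub) and RED (`RedSlowLaw`, parked)
(✓ `…SlowCoreDefs`, `heavyTopSlowLaw_of_irr_red`).  WHICH of the two does the census price?  Every ✗ witness of record — the census
placements (`NFive`-type bands, `P₁₀`, …, the SAT placements of rows `13–16`) and the block paths — is a COORDINATE PATTERN PENCIL with
constant part `0` and strictly upper tops, so the unital algebra its values generate is upper triangular, a proper subalgebra: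

* `upper_of_mem_pencilAlg_patPencil` — for a strictly upper placement every element of `pencilAlg (patPencil pos)` is upper triangular
  (`Algebra.adjoin_induction`; products of upper triangular matrices are upper triangular);
* ★ `pencilAlg_patPencil_ne_top` — hence `pencilAlg (patPencil pos) ≠ ⊤` as soon as `m ≥ 2`: **pattern pencils lie on the REDUCIBLE locus**;
* `exists_not_slow_red_of_blockPaths` — the block-path witness of ✓ `exists_not_slow_of_blockPaths` with the extra conjunct `pencilAlg N ≠ ⊤`;
  `exists_not_slow_red_sliver_of_le` — rows `n ≥ 18` (same `q = ⌊√(2n)⌋ + 2`, `m = (⌊(n−1)/2⌋+1)·q`, `m² < n³`);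
* ★★★ `not_redSlowInst_family_one` — for every `n₀` the instance family of RED with `C₀ = 1` is FALSE; ★★★ `two_le_of_redSlowLaw_witness` — any
  constant witnessing `RedSlowLaw` is `≥ 2`; `redSlowLaw_iff_two_le`.

READING (for the `slow_core` line).  The whole ✗ side of the census — finite rows and the uniform block paths alike — is a statement about RED:
«RED cannot hold with `C₀ = 1`; any proof of RED pays `C₀ ≥ 2`».  It says NOTHING about IRR: no irreducible (`pencilAlg = ⊤`) ✗ witness exists
in any currency at any cell (the certified irreducible monoliths `W₅ … W(11)`, `S₃(m)` are all weight-thin / flag-cheap where tested, GRID §0 C),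
so `IrrSlowLaw` with `C₀ = 1` is NOT excluded by anything in the tree.

HONEST LABEL.  Prices the constant of the PARKED stub RED; refutes nothing (`RedSlowLaw`, `IrrSlowLaw`, R2ᵖ, R2, S3b, 24318, rung 8062, `VP ≠ VNP`
all OPEN / NOT moved).  `--supports stmt-ValiantsHypothesis-24318` (Negative path).  No definitions, no named facts.
[✓ `…HeavyTopInstBlockPaths`; ✓ `…HeavyTopPatternGeneral` (`not_slow_patPencil_placement`); ✓ `…SlowCoreDefs` (`RedSlowLaw`); this seat]
-/

-- `Summit.ValiantsHypothesis.ValiantsHypothesis.…` repeats a component (D-0017 layout); `dupNamespace` would flag the mandated name.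
set_option linter.dupNamespace false
set_option autoImplicit false

noncomputable section

namespace Summit.ValiantsHypothesis.ValiantsHypothesis.Theorems.GrenetZeon.RadicalSplit

open Summit.ValiantsHypothesis.ValiantsHypothesis.Cruxes.TwoDimCoefficients.DimTwoCases (AffMat IsAffine)
open Summit.ValiantsHypothesis.ValiantsHypothesis.Theorems.GrenetZeon.SlowCore (Slow RedSlowLaw)

section Reducible

variable {n m : ℕ}

/-- **The values of a strictly upper pattern pencil generate upper triangular matrices only.** [this file] -/
theorem upper_of_mem_pencilAlg_patPencil (pos : Fin n × Fin n → Fin m × Fin m) (hup : ∀ c, (pos c).1 < (pos c).2)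
    {b : Matrix (Fin m) (Fin m) ℂ} (hb : b ∈ pencilAlg (patPencil pos)) : ∀ i j : Fin m, j < i → b i j = 0 := by
  refine Algebra.adjoin_induction (p := fun b _ => ∀ i j : Fin m, j < i → b i j = 0) ?_ ?_ ?_ ?_ hb
  · rintro _ ⟨x, rfl⟩ i j hij
    show ((patPencil pos).map (MvPolynomial.eval x)) i j = 0
    rw [patPencil_map_eval]
    exact patTop_apply_eq_zero_of_le pos hup x (le_of_lt (Fin.lt_def.1 hij))
  · intro r i j hij
    rw [Algebra.algebraMap_eq_smul_one, Matrix.smul_apply, Matrix.one_apply_ne (ne_of_gt hij), smul_zero]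
  · intro x y _ _ hx hy i j hij
    rw [Matrix.add_apply, hx i j hij, hy i j hij, add_zero]
  · intro x y _ _ hx hy i j hij
    rw [Matrix.mul_apply]
    refine Finset.sum_eq_zero fun k _ => ?_
    by_cases hk : k < i
    · rw [hx i k hk, zero_mul]
    · rw [hy k j (lt_of_lt_of_le hij (not_lt.1 hk)), mul_zero]

/-- ★ **Pattern pencils are REDUCIBLE**: for a strictly upper placement into `m × m`, `m ≥ 2`, the pencil algebra is a proper subalgebra
(the all-ones matrix is not upper triangular). [this file] -/
theorem pencilAlg_patPencil_ne_top (pos : Fin n × Fin n → Fin m × Fin m) (hup : ∀ c, (pos c).1 < (pos c).2) (hm : 2 ≤ m) :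
    pencilAlg (patPencil pos) ≠ ⊤ := by
  intro htop
  have hmem : (Matrix.of fun _ _ => (1 : ℂ)) ∈ pencilAlg (patPencil pos) := by
    rw [htop]
    exact Algebra.mem_top
  have h := upper_of_mem_pencilAlg_patPencil pos hup hmem ⟨1, hm⟩ ⟨0, by omega⟩ (Fin.mk_lt_mk.2 Nat.zero_lt_one)
  simp at h

end Reducible

section Red

variable {s q m : ℕ}

/-- **Block paths, RED form**: under the hypotheses of ✓ `exists_not_slow_of_blockPaths` the witness can be taken REDUCIBLE (it is the pattern
pencil of the block-path placement). [this file] -/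
theorem exists_not_slow_red_of_blockPaths (hn : s + 1 ≤ q * (q - 1) / 2) (hm : (s / 2 + 1) * q ≤ m) (hX : q + s < m)
    (hnum : (s + 1) * (s + 1) ≤ 16 * m * Nat.sqrt (s + 1) + 16 * (s + 1)) :
    ∃ N : AffMat (s + 1) m, IsAffine N ∧ N ^ m = 0 ∧
      (∀ K : Submodule ℂ (Fin (s + 1) × Fin (s + 1) → ℂ), RadOrth (s + 1) m N K →
        Module.finrank ℂ K ≤ 16 * m * Nat.sqrt (s + 1) + 16 * (s + 1)) ∧ pencilAlg N ≠ ⊤ ∧ ¬ Slow (s + 1) m N := by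
  have hq : 2 ≤ q := by
    by_contra h
    interval_cases q <;> omega
  obtain ⟨lab, hinj, hlt⟩ := exists_triangle_labels hn
  obtain ⟨V, X, hpl, hup⟩ := exists_blockPaths_placement lab hinj hlt hm hX
  refine ⟨patPencil (placement V X), isAffine_patPencil _, patPencil_pow_eq_zero _ hup, fun K _ => ?_,
    pencilAlg_patPencil_ne_top _ hup (by omega), not_slow_patPencil_placement V X hpl hup⟩
  have h1 := Submodule.finrank_le K
  rw [Module.finrank_fintype_fun_eq_card, Fintype.card_prod, Fintype.card_fin] at h1
  exact h1.trans hnum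

/-- **Rows `n ≥ 18`, RED form** (the arithmetic of ✓ `exists_not_heavyTopInst_sliver_of_le`: `q = ⌊√(2n)⌋ + 2`, `m = (⌊(n−1)/2⌋+1)·q`,
`m² < n³`). [this file] -/
theorem exists_not_slow_red_sliver_of_le {n : ℕ} (hn : 18 ≤ n) :
    ∃ m : ℕ, 1 * m ^ 2 < n ^ 3 ∧ ∃ N : AffMat n m, IsAffine N ∧ N ^ m = 0 ∧
      (∀ K : Submodule ℂ (Fin n × Fin n → ℂ), RadOrth n m N K → Module.finrank ℂ K ≤ 16 * m * Nat.sqrt n + 16 * n) ∧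
      pencilAlg N ≠ ⊤ ∧ ¬ Slow n m N := by
  obtain ⟨s, rfl⟩ : ∃ s, n = s + 1 := ⟨n - 1, by omega⟩
  set r := Nat.sqrt (2 * (s + 1)) with hr_def
  set t := Nat.sqrt (s + 1) with ht_def
  have F1 : r * r ≤ 2 * (s + 1) := Nat.sqrt_le _
  have F2 : 2 * (s + 1) < (r + 1) * (r + 1) := Nat.lt_succ_sqrt _
  have G2 : s + 1 < (t + 1) * (t + 1) := Nat.lt_succ_sqrt _
  have G3 : t ≤ r := Nat.sqrt_le_sqrt (by omega)
  have hr6 : 6 ≤ r := by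
    by_contra h
    have : (r + 1) * (r + 1) ≤ 6 * 6 := Nat.mul_le_mul (by omega) (by omega)
    omega
  have hrs : r ≤ 2 * (s + 1) := le_trans (Nat.le_mul_self r) F1
  have hlab : s + 1 ≤ (r + 2) * (r + 2 - 1) / 2 := by
    rw [show r + 2 - 1 = r + 1 by omega, Nat.le_div_iff_mul_le (by norm_num)]
    nlinarith [F2]
  have h8 : (s / 2 + 1) * 8 ≤ (s / 2 + 1) * (r + 2) := Nat.mul_le_mul_left _ (by omega)
  have hX : r + 2 + s < (s / 2 + 1) * (r + 2) := by omega
  have hnum : (s + 1) * (s + 1) ≤ 16 * ((s / 2 + 1) * (r + 2)) * Nat.sqrt (s + 1) + 16 * (s + 1) := by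
    rw [← ht_def]
    have d1 : (s / 2 + 1) * (t + 2) ≤ (s / 2 + 1) * (r + 2) := Nat.mul_le_mul_left _ (by omega)
    have d2 : 16 * ((s / 2 + 1) * (t + 2)) * t ≤ 16 * ((s / 2 + 1) * (r + 2)) * t :=
      Nat.mul_le_mul_right _ (Nat.mul_le_mul_left _ d1)
    have d3 : (s + 1) * (s + 1) ≤ (s + 1) * (t * t + 2 * t) := Nat.mul_le_mul_left _ (by nlinarith [G2])
    have d4 : (s + 1) * (t * t + 2 * t) ≤ 2 * (s / 2 + 1) * (t * t + 2 * t) := Nat.mul_le_mul_right _ (by omega)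
    have d5 : 2 * (s / 2 + 1) * (t * t + 2 * t) ≤ 16 * ((s / 2 + 1) * (t + 2)) * t := by
      have : 2 * (s / 2 + 1) * (t * t + 2 * t) = 2 * (((s / 2 + 1) * (t + 2)) * t) := by ring
      rw [this]
      nlinarith
    omega
  have hsl : 1 * ((s / 2 + 1) * (r + 2)) ^ 2 < (s + 1) ^ 3 := by
    have e1 : 12 * r ≤ r * r + 36 := by nlinarith [Nat.zero_le ((r - 6) * (r - 6)), Nat.sub_add_cancel hr6]
    have e2 : 3 * ((r + 2) * (r + 2)) ≤ 8 * (s + 1) + 48 := by nlinarith [e1, F1]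
    have e3 : 2 * (s / 2 + 1) ≤ s + 2 := by omega
    have e4 : (2 * (s / 2 + 1)) * (2 * (s / 2 + 1)) ≤ (s + 2) * (s + 2) := Nat.mul_le_mul e3 e3
    have e5 : 12 * ((s / 2 + 1) * (r + 2)) ^ 2 ≤ (s + 2) * (s + 2) * (8 * (s + 1) + 48) := by
      have : 12 * ((s / 2 + 1) * (r + 2)) ^ 2 = ((2 * (s / 2 + 1)) * (2 * (s / 2 + 1))) * (3 * ((r + 2) * (r + 2))) := by
        ring
      rw [this]
      exact Nat.mul_le_mul e4 e2
    have e6 : 18 * ((s + 1) * (s + 1)) ≤ (s + 1) * ((s + 1) * (s + 1)) := Nat.mul_le_mul_right _ (by omega)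
    have e7 : 18 * (s + 1) ≤ (s + 1) * (s + 1) := Nat.mul_le_mul_right _ (by omega)
    nlinarith [e5, e6, e7]
  exact ⟨(s / 2 + 1) * (r + 2), hsl, exists_not_slow_red_of_blockPaths hlab le_rfl hX hnum⟩

/-- ★★★ **RED's instance family is FALSE at `C₀ = 1` for every threshold `n₀`** (body of `RedSlowLaw` with `C₀ = 1`). [this file] -/
theorem not_redSlowInst_family_one (n₀ : ℕ) :
    ¬ ∀ n ≥ n₀, ∀ m : ℕ, 1 * m ^ 2 < n ^ 3 → ∀ N : AffMat n m, IsAffine N → N ^ m = 0 →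
      (∀ K : Submodule ℂ (Fin n × Fin n → ℂ), RadOrth n m N K → Module.finrank ℂ K ≤ 16 * m * Nat.sqrt n + 16 * n) →
      pencilAlg N ≠ ⊤ → Slow n m N := by
  intro h
  obtain ⟨m, hm, N, hN, hnil, htop, hred, hnot⟩ := exists_not_slow_red_sliver_of_le (n := max n₀ 18) (le_max_right _ _)
  exact hnot (h _ (le_max_left _ _) m hm N hN hnil htop hred)

/-- ★★★ **ANY CONSTANT WITNESSING `RedSlowLaw` IS `≥ 2`.** [this file] -/
theorem two_le_of_redSlowLaw_witness {C₀ n₀ : ℕ}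
    (h : ∀ n ≥ n₀, ∀ m : ℕ, C₀ * m ^ 2 < n ^ 3 → ∀ N : AffMat n m, IsAffine N → N ^ m = 0 →
      (∀ K : Submodule ℂ (Fin n × Fin n → ℂ), RadOrth n m N K → Module.finrank ℂ K ≤ 16 * m * Nat.sqrt n + 16 * n) →
      pencilAlg N ≠ ⊤ → Slow n m N) : 2 ≤ C₀ := by
  by_contra hC
  apply not_redSlowInst_family_one n₀
  intro n hn m hm
  refine h n hn m (lt_of_le_of_lt ?_ hm)
  exact Nat.mul_le_mul_right _ (by omega)

/-- `RedSlowLaw` restated with the priced constant: RED holds iff it holds with some `C₀ ≥ 2`. [this file] -/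
theorem redSlowLaw_iff_two_le :
    RedSlowLaw ↔ ∃ C₀ n₀ : ℕ, 2 ≤ C₀ ∧ ∀ n ≥ n₀, ∀ m : ℕ, C₀ * m ^ 2 < n ^ 3 → ∀ N : AffMat n m, IsAffine N → N ^ m = 0 →
      (∀ K : Submodule ℂ (Fin n × Fin n → ℂ), RadOrth n m N K → Module.finrank ℂ K ≤ 16 * m * Nat.sqrt n + 16 * n) →
      pencilAlg N ≠ ⊤ → Slow n m N := by
  constructor
  · rintro ⟨C₀, n₀, h⟩
    exact ⟨C₀, n₀, two_le_of_redSlowLaw_witness h, h⟩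
  · rintro ⟨C₀, n₀, -, h⟩
    exact ⟨C₀, n₀, h⟩

end Red

end Summit.ValiantsHypothesis.ValiantsHypothesis.Theorems.GrenetZeon.RadicalSplit

end
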